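import Summits.QuantumFields.BalabanUV.Beta.GAN24.W3ForcingOfZS
import Summits.QuantumFields.BalabanUV.Beta.GAN24.W3ForcingSymZ
import Summits.QuantumFields.BalabanUV.Beta.GAN24.WSlotFirstDiff

/-!
# `BalabanUV.Beta.GAN24.W3DriftOfZS` — binder row G-an2-4 / (CONV-C), W-slot road «W3» (gan24-p1-g5 `SKELETON-W3.md` v1.0.2 §8.3; ENDs
# `WSlotT2OfPieces` p213240): **END #2 COMPOSED BY NAME AT `d = 3`, `Lc ≥ 2` — «T2Drift» (one-step geometric rate, Cauchy form, entrywise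
# «T2SupRate») FOR an2's NORMALISED STAGE-B FAMILY, MODULO ROW W3-F2a (source zero modes), ROW W3-F4d's PIN HALF (the cell zero mode of the
# FIRST DIFFERENCE) AND THE PIN ONLY** (G-an2-4 formalisation swarm, leaf prover 08 = the ROW W3-F4a∕F4b lineage, gen 20; journal INTENT
# «W3-F4B-OF-ZS*» l.10226, PART 2; module name PROVISIONAL)

NOT IN PRINT; OUR PROOF ([folklore] composition BY NAME, zero analytic content added).  A SOCKET CERTIFICATE, NOT THE END HEADLINE: the W-rows
`hW₂`∕`hW₂all` of §8.4 and END #3 `WSlotT2Tables` are the row OWNER's; this module may be absorbed ∕ renamed there.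
HONEST FRAMING (cell contract, verbatim): «discharging `BetaPertH` makes Bałaban's UV stability UNCONDITIONAL — a real constructive-QFT result; it
is NOT the continuum limit and NOT the Clay problem.»  HONEST DEPENDENCY (verbatim): «continuum YM on T⁴ ⇐ BetaPertH ∧ nine spine estimates (0/9
proved); BetaPertH ⇐ (D1) ∧ (D4) ∧ CAP+tail; G-an2-4 gates asym, D1 and NE2/3/4.»

PLUGS (all BY NAME, tree theorems): F1b `hsplit` = leaf-01's `T2UnitSplitShapes.unitS₂_T2Of_sub_eq_transport_add_sum_vh₂S_of_mix` (p213113;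
`P′ 0 n ≡ transport 1 n`, `P′ (i+1) ≡ transport (i+2)` by offset unification, cf. leaf-02-g16's probe T3 l.10186); F3b `hTirr` at the SHIFTED transport
`P′ m k := P (m+1) k` = leaf-12's `TransportIrrelevant.hTirr_three_slot` (p213474; record `Zfree`, pin-conditional — ref2 R57-2: the difference tower
carries `hpin` too), K-slot `KSlotAssembly.convCKWall_holds`; F4b `hf` = THIS lineage's `W3ForcingOfZS.hf_three_of_F2a` (PART 1: ROW W3-F4b as a
function of F2a and the pin, `hx` by leaf-12's `T2ShapeThreeOfF2a`); F2b `hZf` = leaf-18's `WSlotForcingZeroModeW3.hZf_of_hZ_W3` (p213958; its `hb` =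
`W3SourceRowsEnd.hb_three`); F4d SHAPE half `h0` = leaf-07's `WSlotFirstDiff.hD0_pair` (p211381∕tree); covariance conjuncts by leaf-11's
`T2OfBracketBlockCovariance.bracket_translate_block_base` (sources) and leaf-19's `T2SlotCovariance.T2diff_translate` (first difference).  RATES
(ref2 R57-3 (w10′)): the difference tower's input rate is `δin′ := min δf δ₀` — F4b's `δf` (chosen AFTER END #1's output inside PART 1) and F4d's
`δ₀` —, F3b is taken AT `δin′` (`hTirr_three_slot` is ∀-input-rate) and returns the output rate `δT`; `ρ := Lc⁻¹` (`TransportRows.inv_natCast_*`),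
`mom := fun _ ↦ 0` (R57-2 (b)).

WHAT (`d = 3`, `2 ≤ Lc`; `T♮_j := unitS₂ (sfStep Lc j) (smStep 3 Lc j) (T2Of 3 Lc cE cVH cΛ cE₂ cB Tc (vh₂S 3 Lc) mixFF j)`, `b♮_m` = leaf-04's bracket):
* §1 generic mixed table (ROWS-MIX `hmix hδ₄ hfm hm` + an2's block covariance `hmixt`): **`t2Drift_three_of_F2a_Z0`** — «T2Drift» ⇐ pin ∧ ROW W3-F2a
  `∀ m, Zfree (b♮_m)` (record form) ∧ `Zfree (T♮₁ − T♮₀)` (ROW W3-F4d's pin half, record form); **`t2Drift_three_of_F2acell_Z0cell`** — the same from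
  the CELL ZERO MODES ALONE (covariance conjuncts are tree theorems); **`t2Drift_three_of_F2asym_Z0sym`** — the `ZfreeSym` currency (bond-SYMMETRISED
  cell charges; leaf-12-g21's THIRD REPAIR of the F4d ⊥, l.10219∕l.10343).  Conclusion = the three conclusions of `WSlotT2OfPieces.t2Drift_of_rows`, rate
  exported: `∃ c ϑ δT, 0 ≤ c ∧ 0 < ϑ ∧ ϑ < 1 ∧ 0 < δT ∧ (∀ n, LocStencil₂ (T♮_{n+1} − T♮_n) (c·ϑ^n) δT) ∧ (∀ k j, LocStencil₂ (T♮_{k+j} − T♮_k) (c·(1−ϑ)⁻¹·ϑ^k) δT)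
  ∧ (∀ n κ u κ′ u′ x z a b, |T♮_{n+1} … − T♮_n …| ≤ c·ϑ^n)`.
* §2 an1's mixed table `mixFFAt (toSite r) Lc`, `r ∈ box (3+1) Lc` (ROWS-MIX and `hmixt` discharged by `MixedJetTablesPlug.hmix_an1` ∕ `hmixt_an1`,
  `WSlotMixedShape.mixFFAt_hfm` ∕ `mixFFAt_hm`): **`t2Drift_three_an1_of_F2asym_Z0sym`**.
* §3 BOTH ENDs AT ONCE (`ZfreeSym` currency): **`t2ShapeDrift_three_of_F2asym_Z0sym`** ∕ **`t2ShapeDrift_three_an1_of_F2asym_Z0sym`** — «T2Shape»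
  (leaf-12's `t2Shape_three_of_F2a_symZ` ∕ `t2Shape_three_an1_of_F2a_symZ`) ∧ «T2Drift» (§1∕§2) ⇐ pin ∧ F2a-sym ∧ F4d-pin-sym.
HONEST: ROW W3-F2a (leaf-20, OPEN), ROW W3-F4d's pin half (leaf-07; ⚠ leaf-18-g17's tree theorem `WilsonQuarticChargeOffDiag.not_hZ0_of_hZb0_w22`
(l.10060): AT `Tc := PlaquetteVertex2Trace.w22 N`, `cE₂ ≠ 0`, the hypotheses «F2a at m = 0» and «F4d pin half» are JOINTLY UNSATISFIABLE — for
that table these certificates are VACUOUS; they are stated for a generic `Tc` (for a bond-symmetric `Tc` nothing bites) and the owner's (R1)∕(R2)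
ruling on the table of record ∕ the `D₁`-unrolled END is awaited), the pin (an2's (P6)) and ROWS-MIX remain HYPOTHESES; asserts NO shape or rate of
Bałaban's tables by itself; «T2Shape»∕«T2SupRate»∕«T2Drift» remain OPEN, NOT IN PRINT; discharges NOTHING of (hW₂, hW₂all), the window, the (D1)
identification; wall binders: K 2∕2, S 2∕2 are tree theorems at d = 3, Lc ≥ 2, W 0∕2 (this module: reduction only); NOT «W-slot closed» — never under an undischarged pin; NEVER «G-an2-4 closed», NOT (CONV-C); NOT
`BetaPertH`, NOT continuum, NOT Clay.  0 cited facts, 0 `def`, 0 `def … : Prop`, 0 sorry.  Unit `b2b-balaban-gan24-formalise-leaf-08`, gen 20, 2026-08-20.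
-/

noncomputable section

open Literature.MathematicalPhysics.QuantumFieldTheory
open Literature.MathematicalPhysics.QuantumFieldTheory.Balaban1983to89
open Literature.MathematicalPhysics.QuantumFieldTheory.Balaban1983to89.Beta
open AffineAveraging (box toSite)
open ExpKernelCalculus (MKer shiftK)
open OneStepResolventKernel (Fib)
open OneStepKernelFamily (KInvStep)
open StepJetData (mfNeg)
open SecondOrderResponse (W2SymOfK LocStencilFM)
open BalabanCompositeJets (LocStencil₂)
open BalabanStepJetsSucc (mmRead)
open BalabanStepW2 (K3OfK Spure M1 M2Of T2Of)
open AveragingMixedJetTables (vh₂S mixFFAt)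
open Summit.QuantumFields.BalabanUV.Beta.HessKerDressedUnits (unitK unitS)
open Summit.QuantumFields.BalabanUV.Beta.SecondOrderUnits (unitM unitS₂ unitM₂)
open Summit.QuantumFields.BalabanUV.Beta.MixedJetTablesPlug (hmix_an1 hmixt_an1)
open Summit.QuantumFields.BalabanUV.Beta.GAN24.CombesThomas (sfStep smStep)
open Summit.QuantumFields.BalabanUV.Beta.GAN24.StencilSlotOfE3 (one_le_of_two_le)
open Summit.QuantumFields.BalabanUV.Beta.GAN24.Push4Iter (BiTab)
open Summit.QuantumFields.BalabanUV.Beta.GAN24.AffineUnroll (transport)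
open Summit.QuantumFields.BalabanUV.Beta.GAN24.BiStencilZeroMode (zmode)
open Summit.QuantumFields.BalabanUV.Beta.GAN24.T2RecursionAffine (lin4)
open Summit.QuantumFields.BalabanUV.Beta.GAN24.KSlotAssembly (convCKWall_holds)
open Summit.QuantumFields.BalabanUV.Beta.GAN24.T2SlotCovariance (T2diff_translate)
open Summit.QuantumFields.BalabanUV.Beta.GAN24.T2OfBracketBlockCovariance (bracket_translate_block_base)
open Summit.QuantumFields.BalabanUV.Beta.GAN24.T2UnitSplitShapes (unitS₂_T2Of_sub_eq_transport_add_sum_vh₂S_of_mix)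
open Summit.QuantumFields.BalabanUV.Beta.GAN24.TransportIrrelevant (hTirr_three_slot)
open Summit.QuantumFields.BalabanUV.Beta.GAN24.TransportIrrelevantSym (hTirr_three_symZ_slot)
open Summit.QuantumFields.BalabanUV.Beta.GAN24.W3ForcingSymZ (forcing_zfreeSym_of_source)
open Summit.QuantumFields.BalabanUV.Beta.GAN24.TransportRows (inv_natCast_nonneg inv_natCast_lt_one)
open Summit.QuantumFields.BalabanUV.Beta.GAN24.WSlotT2OfPieces (t2Drift_of_rows)
open Summit.QuantumFields.BalabanUV.Beta.GAN24.WSlotFirstDiff (hD0_pair)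
open Summit.QuantumFields.BalabanUV.Beta.GAN24.WSlotForcingZeroModeW3 (hZf_of_hZ_W3)
open Summit.QuantumFields.BalabanUV.Beta.GAN24.WSlotMixedShape (mixFFAt_hfm mixFFAt_hm)
open Summit.QuantumFields.BalabanUV.Beta.GAN24.W3SourceRowsEnd (hb_three)
open Summit.QuantumFields.BalabanUV.Beta.GAN24.T2ShapeThreeOfF2a (t2Shape_three_of_F2a t2Shape_three_of_F2a_symZ t2Shape_three_an1_of_F2a_symZ)
open Summit.QuantumFields.BalabanUV.Beta.GAN24.W3ForcingOfZS (hf_three_of_F2a hf_three_of_F2asym)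

namespace Summit.QuantumFields.BalabanUV.Beta.GAN24.W3DriftOfZS

/-! ## §1 Generic mixed table: END #2 modulo ROW W3-F2a, ROW W3-F4d's pin half and the pin -/

section Three

variable {Lc : ℕ} [NeZero Lc]

/-- **END #2 COMPOSED BY NAME, generic mixed table, record-`Zfree` forms**: at `d = 3`, `Lc ≥ 2`, UNDER THE PIN, for a mixed table with ROWS-MIX
(`hmix hδ₄ hfm hm`) and an2's block covariance `hmixt`: if every source `b♮_m` is `Zfree` (ROW W3-F2a, record form: jointly `Lc`-covariant ∧ cell ff
zero mode) and the first difference `T♮₁ − T♮₀` is `Zfree` (ROW W3-F4d's pin half), then the one-step differences of an2's normalised Stage-B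
family decay geometrically in `LocStencil₂` at ONE positive rate — «T2Drift» in its one-step, Cauchy and entrywise forms (`WSlotT2OfPieces.t2Drift_of_rows`
with F1b ∕ F3b ∕ F4b ∕ F2b ∕ F4d-shape plugged BY NAME, see the module docstring; `mom := fun _ ↦ 0`, `ρ := Lc⁻¹`, input rate `min δf δ₀`).
⚠ At `Tc := w22 N`, `cE₂ ≠ 0` the hypotheses `hZ 0` ∧ `hZ0` are jointly unsatisfiable (leaf-18-g17's `not_hZ0_of_hZb0_w22`); see `t2Drift_three_of_F2asym_Z0sym`. -/
theorem t2Drift_three_of_F2a_Z0 (hLc : 2 ≤ Lc) (cE cVH cΛ cE₂ cB : ℝ) (Tc : Fin 4 → Fin 4 → Fin 4 → Fin 4 → ℝ)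
    {mixFF : BiTab 3} {CM₂ δ₄ : ℝ} (hmix : LocStencilFM Lc mixFF CM₂ δ₄) (hδ₄ : 0 < δ₄)
    (hfm : ∀ κ u ρ w x z (α μ' : Fin (3 + 1)), mixFF κ u ρ w x z (Sum.inl α) (Sum.inr μ') = 0)
    (hm : ∀ κ u ρ w x z (μ' : Fin (3 + 1)) (b : Fib 3), mixFF κ u ρ w x z (Sum.inr μ') b = 0)
    (hmixt : ∀ (κ : Fin (3 + 1)) (u : Fin (3 + 1) → ℤ) (ρ : Fin (3 + 1)) (w t : Fin (3 + 1) → ℤ),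
      mixFF κ (u + (Lc : ℤ) • t) ρ (w + t) = shiftK (-((Lc : ℤ) • t)) (mixFF κ u ρ w))
    (hpin : |cE₂| ≤ (Lc : ℝ) ^ (2 * (3 + 1)))
    (hZ : ∀ m : ℕ, (∀ κ u κ' u' t, (fun κ u κ' u' =>
        (cE₂ * (Lc : ℝ) ^ (2 * (3 + 1))) •
            mmRead Lc (K3OfK (unitK (sfStep Lc m) (smStep 3 Lc m) (KInvStep (d := 3) Lc m)) Lc
              (unitS (sfStep Lc m) (smStep 3 Lc m) (Spure 3 Lc cE cVH cΛ m)) (unitM (sfStep Lc m) (smStep 3 Lc m) (M1 3 Lc cΛ m))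
              (W2SymOfK (unitK (sfStep Lc m) (smStep 3 Lc m) (KInvStep (d := 3) Lc m)) Lc
                (unitS (sfStep Lc m) (smStep 3 Lc m) (Spure 3 Lc cE cVH cΛ m)) (unitM (sfStep Lc m) (smStep 3 Lc m) (M1 3 Lc cΛ m)) 0
                (unitM₂ (sfStep Lc m) (smStep 3 Lc m) (M2Of 3 Lc mixFF m))) κ u κ' u')
          + cB • mfNeg ((vh₂S 3 Lc) κ u κ' u')) κ (u + (Lc : ℤ) • t) κ' (u' + (Lc : ℤ) • t) = shiftK (-((Lc : ℤ) • t)) ((fun κ u κ' u' =>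
        (cE₂ * (Lc : ℝ) ^ (2 * (3 + 1))) •
            mmRead Lc (K3OfK (unitK (sfStep Lc m) (smStep 3 Lc m) (KInvStep (d := 3) Lc m)) Lc
              (unitS (sfStep Lc m) (smStep 3 Lc m) (Spure 3 Lc cE cVH cΛ m)) (unitM (sfStep Lc m) (smStep 3 Lc m) (M1 3 Lc cΛ m))
              (W2SymOfK (unitK (sfStep Lc m) (smStep 3 Lc m) (KInvStep (d := 3) Lc m)) Lc
                (unitS (sfStep Lc m) (smStep 3 Lc m) (Spure 3 Lc cE cVH cΛ m)) (unitM (sfStep Lc m) (smStep 3 Lc m) (M1 3 Lc cΛ m)) 0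
                (unitM₂ (sfStep Lc m) (smStep 3 Lc m) (M2Of 3 Lc mixFF m))) κ u κ' u')
          + cB • mfNeg ((vh₂S 3 Lc) κ u κ' u')) κ u κ' u')) ∧
      (∀ κ κ' κ₁ κ₂, zmode Lc (fun κ u κ' u' =>
        (cE₂ * (Lc : ℝ) ^ (2 * (3 + 1))) •
            mmRead Lc (K3OfK (unitK (sfStep Lc m) (smStep 3 Lc m) (KInvStep (d := 3) Lc m)) Lc
              (unitS (sfStep Lc m) (smStep 3 Lc m) (Spure 3 Lc cE cVH cΛ m)) (unitM (sfStep Lc m) (smStep 3 Lc m) (M1 3 Lc cΛ m))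
              (W2SymOfK (unitK (sfStep Lc m) (smStep 3 Lc m) (KInvStep (d := 3) Lc m)) Lc
                (unitS (sfStep Lc m) (smStep 3 Lc m) (Spure 3 Lc cE cVH cΛ m)) (unitM (sfStep Lc m) (smStep 3 Lc m) (M1 3 Lc cΛ m)) 0
                (unitM₂ (sfStep Lc m) (smStep 3 Lc m) (M2Of 3 Lc mixFF m))) κ u κ' u')
          + cB • mfNeg ((vh₂S 3 Lc) κ u κ' u')) κ κ' (Sum.inl κ₁) (Sum.inl κ₂) = 0))
    (hZ0 : (∀ κ u κ' u' t, (fun κ u κ' u' => unitS₂ (sfStep Lc 1) (smStep 3 Lc 1) (T2Of 3 Lc cE cVH cΛ cE₂ cB Tc (vh₂S 3 Lc) mixFF 1) κ u κ' u' - unitS₂ (sfStep Lc 0) (smStep 3 Lc 0) (T2Of 3 Lc cE cVH cΛ cE₂ cB Tc (vh₂S 3 Lc) mixFF 0) κ u κ' u') κ (u + (Lc : ℤ) • t) κ' (u' + (Lc : ℤ) • t) = shiftK (-((Lc : ℤ) • t)) ((fun κ u κ' u' => unitS₂ (sfStep Lc 1) (smStep 3 Lc 1) (T2Of 3 Lc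 cE cVH cΛ cE₂ cB Tc (vh₂S 3 Lc) mixFF 1) κ u κ' u' - unitS₂ (sfStep Lc 0) (smStep 3 Lc 0) (T2Of 3 Lc cE cVH cΛ cE₂ cB Tc (vh₂S 3 Lc) mixFF 0) κ u κ' u') κ u κ' u')) ∧
      (∀ κ κ' κ₁ κ₂, zmode Lc (fun κ u κ' u' => unitS₂ (sfStep Lc 1) (smStep 3 Lc 1) (T2Of 3 Lc cE cVH cΛ cE₂ cB Tc (vh₂S 3 Lc) mixFF 1) κ u κ' u' - unitS₂ (sfStep Lc 0) (smStep 3 Lc 0) (T2Of 3 Lc cE cVH cΛ cE₂ cB Tc (vh₂S 3 Lc) mixFF 0) κ u κ' u') κ κ' (Sum.inl κ₁) (Sum.inl κ₂) = 0)) :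
    ∃ c ϑ δT : ℝ, 0 ≤ c ∧ 0 < ϑ ∧ ϑ < 1 ∧ 0 < δT ∧
      (∀ n, LocStencil₂ (fun κ u κ' u' => unitS₂ (sfStep Lc (n + 1)) (smStep 3 Lc (n + 1)) (T2Of 3 Lc cE cVH cΛ cE₂ cB Tc (vh₂S 3 Lc) mixFF (n + 1)) κ u κ' u' - unitS₂ (sfStep Lc n) (smStep 3 Lc n) (T2Of 3 Lc cE cVH cΛ cE₂ cB Tc (vh₂S 3 Lc) mixFF n) κ u κ' u') (c * ϑ ^ n) δT) ∧
      (∀ k j, LocStencil₂ (fun κ u κ' u' => unitS₂ (sfStep Lc (k + j)) (smStep 3 Lc (k + j)) (T2Of 3 Lc cE cVH cΛ cE₂ cB Tc (vh₂S 3 Lc) mixFF (k + j)) κ u κ' u' - unitS₂ (sfStep Lc k) (smStep 3 Lc k) (T2Of 3 Lc cE cVH cΛ cE₂ cB Tc (vh₂S 3 Lc) mixFF k) κ u κ' u') (c * (1 - ϑ)⁻¹ * ϑ ^ k) δT) ∧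
      (∀ n κ u κ' u' x z a b, |unitS₂ (sfStep Lc (n + 1)) (smStep 3 Lc (n + 1)) (T2Of 3 Lc cE cVH cΛ cE₂ cB Tc (vh₂S 3 Lc) mixFF (n + 1)) κ u κ' u' x z a b - unitS₂ (sfStep Lc n) (smStep 3 Lc n) (T2Of 3 Lc cE cVH cΛ cE₂ cB Tc (vh₂S 3 Lc) mixFF n) κ u κ' u' x z a b| ≤ c * ϑ ^ n) := by
  have hLc1 : 1 ≤ Lc := one_le_of_two_le hLc
  obtain ⟨C, δ, cK, θK, hδ, -, -, hK, -⟩ := convCKWall_holds (Lc := Lc) hLc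
  obtain ⟨Cf, θ, δf, hCf, hθ0, hθ1, hδf, hf⟩ := hf_three_of_F2a hLc cE cVH cΛ cE₂ cB Tc hmix hδ₄ hfm hm hpin hZ
  obtain ⟨C₀, δ₀, hδ₀, h0⟩ := hD0_pair (d := 3) hLc1 cE cVH cΛ cE₂ cB Tc ⟨CM₂, δ₄, hδ₄, hmix⟩
  obtain ⟨Cb, δb, hCb, hδb, hb⟩ := hb_three hLc cE cVH cΛ cE₂ cB hmix hδ₄ hfm hm
  obtain ⟨CT', δT, hCT', hδT, -, hTi⟩ := hTirr_three_slot hLc1 hK hδ cE₂ (lt_min hδf hδ₀) (fun _ => (0 : ℝ))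
  obtain ⟨c, ϑ, hc, hϑ0, hϑ1, h1, h2, h3⟩ := t2Drift_of_rows (d := 3) cE cVH cΛ cE₂ cB Tc mixFF
    (fun m => ((lin4 (cE₂ * (Lc : ℝ) ^ (2 * (3 + 1))) (unitK (sfStep Lc (m + 1)) (smStep 3 Lc (m + 1)) (KInvStep (d := 3) Lc (m + 1))) Lc
              (unitS₂ (sfStep Lc m) (smStep 3 Lc m) (T2Of 3 Lc cE cVH cΛ cE₂ cB Tc (vh₂S 3 Lc) mixFF m))
          - lin4 (cE₂ * (Lc : ℝ) ^ (2 * (3 + 1))) (unitK (sfStep Lc m) (smStep 3 Lc m) (KInvStep (d := 3) Lc m)) Lc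
              (unitS₂ (sfStep Lc m) (smStep 3 Lc m) (T2Of 3 Lc cE cVH cΛ cE₂ cB Tc (vh₂S 3 Lc) mixFF m)))
        + ((fun κ u κ' u' =>
        (cE₂ * (Lc : ℝ) ^ (2 * (3 + 1))) •
            mmRead Lc (K3OfK (unitK (sfStep Lc (m + 1)) (smStep 3 Lc (m + 1)) (KInvStep (d := 3) Lc (m + 1))) Lc
              (unitS (sfStep Lc (m + 1)) (smStep 3 Lc (m + 1)) (Spure 3 Lc cE cVH cΛ (m + 1))) (unitM (sfStep Lc (m + 1)) (smStep 3 Lc (m + 1)) (M1 3 Lc cΛ (m + 1)))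
              (W2SymOfK (unitK (sfStep Lc (m + 1)) (smStep 3 Lc (m + 1)) (KInvStep (d := 3) Lc (m + 1))) Lc
                (unitS (sfStep Lc (m + 1)) (smStep 3 Lc (m + 1)) (Spure 3 Lc cE cVH cΛ (m + 1))) (unitM (sfStep Lc (m + 1)) (smStep 3 Lc (m + 1)) (M1 3 Lc cΛ (m + 1))) 0
                (unitM₂ (sfStep Lc (m + 1)) (smStep 3 Lc (m + 1)) (M2Of 3 Lc mixFF (m + 1)))) κ u κ' u')
          + cB • mfNeg ((vh₂S 3 Lc) κ u κ' u'))
          - (fun κ u κ' u' =>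
        (cE₂ * (Lc : ℝ) ^ (2 * (3 + 1))) •
            mmRead Lc (K3OfK (unitK (sfStep Lc m) (smStep 3 Lc m) (KInvStep (d := 3) Lc m)) Lc
              (unitS (sfStep Lc m) (smStep 3 Lc m) (Spure 3 Lc cE cVH cΛ m)) (unitM (sfStep Lc m) (smStep 3 Lc m) (M1 3 Lc cΛ m))
              (W2SymOfK (unitK (sfStep Lc m) (smStep 3 Lc m) (KInvStep (d := 3) Lc m)) Lc
                (unitS (sfStep Lc m) (smStep 3 Lc m) (Spure 3 Lc cE cVH cΛ m)) (unitM (sfStep Lc m) (smStep 3 Lc m) (M1 3 Lc cΛ m)) 0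
                (unitM₂ (sfStep Lc m) (smStep 3 Lc m) (M2Of 3 Lc mixFF m))) κ u κ' u')
          + cB • mfNeg ((vh₂S 3 Lc) κ u κ' u')))))
    (fun m k => transport (fun j => lin4 (cE₂ * (Lc : ℝ) ^ (2 * (3 + 1))) (unitK (sfStep Lc j) (smStep 3 Lc j) (KInvStep (d := 3) Lc j)) Lc) (m + 1) k)
    (fun X => (∀ κ u κ' u' t, X κ (u + (Lc : ℤ) • t) κ' (u' + (Lc : ℤ) • t) = shiftK (-((Lc : ℤ) • t)) (X κ u κ' u')) ∧
      (∀ κ κ' κ₁ κ₂, zmode Lc X κ κ' (Sum.inl κ₁) (Sum.inl κ₂) = 0))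
    (fun _ => (0 : ℝ)) hδT hCT' inv_natCast_nonneg (inv_natCast_lt_one hLc) hθ0 hθ1
    (fun n => unitS₂_T2Of_sub_eq_transport_add_sum_vh₂S_of_mix cE cVH cΛ cE₂ cB Tc mixFF hLc1 ⟨CM₂, δ₄, hδ₄, hmix⟩ n)
    (fun m k X C' hC hX hZX hmX => hTi hpin (m + 1) k X C' hC hX hZX hmX)
    (hf (min_le_left _ _))
    (fun m => hZf_of_hZ_W3 (d := 3) hLc1 cE cVH cΛ cE₂ cB Tc ⟨CM₂, δ₄, hδ₄, hmix⟩ hmixt hδb (fun j => (hb le_rfl j).1) hZ m)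
    (h0 _ (min_le_right _ _)) hZ0
  exact ⟨c, ϑ, δT, hc, hϑ0, hϑ1, hδT, h1, h2, h3⟩

/-- **END #2 COMPOSED BY NAME, generic mixed table, FROM THE CELL ZERO MODES ALONE** (record currency): as `t2Drift_three_of_F2a_Z0`, taking ROW
W3-F2a as `∀ m κ κ′ κ₁ κ₂, zmode Lc b♮_m κ κ′ ff = 0` and ROW W3-F4d's pin half as `∀ κ κ′ κ₁ κ₂, zmode Lc (T♮₁ − T♮₀) κ κ′ ff = 0`; the covariance
conjuncts are leaf-11's `bracket_translate_block_base` and leaf-19's `T2diff_translate` (binder `hmixt`). -/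
theorem t2Drift_three_of_F2acell_Z0cell (hLc : 2 ≤ Lc) (cE cVH cΛ cE₂ cB : ℝ) (Tc : Fin 4 → Fin 4 → Fin 4 → Fin 4 → ℝ)
    {mixFF : BiTab 3} {CM₂ δ₄ : ℝ} (hmix : LocStencilFM Lc mixFF CM₂ δ₄) (hδ₄ : 0 < δ₄)
    (hfm : ∀ κ u ρ w x z (α μ' : Fin (3 + 1)), mixFF κ u ρ w x z (Sum.inl α) (Sum.inr μ') = 0)
    (hm : ∀ κ u ρ w x z (μ' : Fin (3 + 1)) (b : Fib 3), mixFF κ u ρ w x z (Sum.inr μ') b = 0)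
    (hmixt : ∀ (κ : Fin (3 + 1)) (u : Fin (3 + 1) → ℤ) (ρ : Fin (3 + 1)) (w t : Fin (3 + 1) → ℤ),
      mixFF κ (u + (Lc : ℤ) • t) ρ (w + t) = shiftK (-((Lc : ℤ) • t)) (mixFF κ u ρ w))
    (hpin : |cE₂| ≤ (Lc : ℝ) ^ (2 * (3 + 1)))
    (hZ : ∀ m : ℕ, (∀ κ κ' κ₁ κ₂, zmode Lc (fun κ u κ' u' =>
        (cE₂ * (Lc : ℝ) ^ (2 * (3 + 1))) •
            mmRead Lc (K3OfK (unitK (sfStep Lc m) (smStep 3 Lc m) (KInvStep (d := 3) Lc m)) Lc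
              (unitS (sfStep Lc m) (smStep 3 Lc m) (Spure 3 Lc cE cVH cΛ m)) (unitM (sfStep Lc m) (smStep 3 Lc m) (M1 3 Lc cΛ m))
              (W2SymOfK (unitK (sfStep Lc m) (smStep 3 Lc m) (KInvStep (d := 3) Lc m)) Lc
                (unitS (sfStep Lc m) (smStep 3 Lc m) (Spure 3 Lc cE cVH cΛ m)) (unitM (sfStep Lc m) (smStep 3 Lc m) (M1 3 Lc cΛ m)) 0
                (unitM₂ (sfStep Lc m) (smStep 3 Lc m) (M2Of 3 Lc mixFF m))) κ u κ' u')
          + cB • mfNeg ((vh₂S 3 Lc) κ u κ' u')) κ κ' (Sum.inl κ₁) (Sum.inl κ₂) = 0))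
    (hZ0 : (∀ κ κ' κ₁ κ₂, zmode Lc (fun κ u κ' u' => unitS₂ (sfStep Lc 1) (smStep 3 Lc 1) (T2Of 3 Lc cE cVH cΛ cE₂ cB Tc (vh₂S 3 Lc) mixFF 1) κ u κ' u' - unitS₂ (sfStep Lc 0) (smStep 3 Lc 0) (T2Of 3 Lc cE cVH cΛ cE₂ cB Tc (vh₂S 3 Lc) mixFF 0) κ u κ' u') κ κ' (Sum.inl κ₁) (Sum.inl κ₂) = 0)) :
    ∃ c ϑ δT : ℝ, 0 ≤ c ∧ 0 < ϑ ∧ ϑ < 1 ∧ 0 < δT ∧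
      (∀ n, LocStencil₂ (fun κ u κ' u' => unitS₂ (sfStep Lc (n + 1)) (smStep 3 Lc (n + 1)) (T2Of 3 Lc cE cVH cΛ cE₂ cB Tc (vh₂S 3 Lc) mixFF (n + 1)) κ u κ' u' - unitS₂ (sfStep Lc n) (smStep 3 Lc n) (T2Of 3 Lc cE cVH cΛ cE₂ cB Tc (vh₂S 3 Lc) mixFF n) κ u κ' u') (c * ϑ ^ n) δT) ∧
      (∀ k j, LocStencil₂ (fun κ u κ' u' => unitS₂ (sfStep Lc (k + j)) (smStep 3 Lc (k + j)) (T2Of 3 Lc cE cVH cΛ cE₂ cB Tc (vh₂S 3 Lc) mixFF (k + j)) κ u κ' u' - unitS₂ (sfStep Lc k) (smStep 3 Lc k) (T2Of 3 Lc cE cVH cΛ cE₂ cB Tc (vh₂S 3 Lc) mixFF k) κ u κ' u') (c * (1 - ϑ)⁻¹ * ϑ ^ k) δT) ∧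
      (∀ n κ u κ' u' x z a b, |unitS₂ (sfStep Lc (n + 1)) (smStep 3 Lc (n + 1)) (T2Of 3 Lc cE cVH cΛ cE₂ cB Tc (vh₂S 3 Lc) mixFF (n + 1)) κ u κ' u' x z a b - unitS₂ (sfStep Lc n) (smStep 3 Lc n) (T2Of 3 Lc cE cVH cΛ cE₂ cB Tc (vh₂S 3 Lc) mixFF n) κ u κ' u' x z a b| ≤ c * ϑ ^ n) :=
  t2Drift_three_of_F2a_Z0 hLc cE cVH cΛ cE₂ cB Tc hmix hδ₄ hfm hm hmixt hpin
    (fun m => ⟨fun κ u κ' u' t => bracket_translate_block_base (d := 3) (one_le_of_two_le hLc) cE cVH cΛ cE₂ cB hmixt m κ u κ' u' t, hZ m⟩)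
    ⟨fun κ u κ' u' t => T2diff_translate (d := 3) (one_le_of_two_le hLc) cE cVH cΛ cE₂ cB Tc hmixt 0 κ u κ' u' t, hZ0⟩

/-- **END #2 COMPOSED BY NAME, generic mixed table, IN THE BOND-SYMMETRISED CURRENCY `Zfree := ZfreeSym`** (leaf-12-g21's THIRD REPAIR of the
F4d ⊥, l.10219 — the currency in which ROW W3-F4d's pin half HOLDS at the exact pin for EVERY `Tc`, `FirstDiffSymCharge.hZ0_symZ_three`): UNDER THE
PIN, if every source `b♮_m` has vanishing bond-symmetrised cell ff charge (ROW W3-F2a, sym form) and so has the first difference `T♮₁ − T♮₀` (ROW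
W3-F4d's pin half, sym form), then «T2Drift» holds — F3b by leaf-12's `TransportIrrelevantSym.hTirr_three_symZ_slot`, F4b by THIS lineage's
`W3ForcingOfZS.hf_three_of_F2asym`, F2b by `W3ForcingSymZ.forcing_zfreeSym_of_source`, the covariance conjuncts by `hmixt` as above. -/
theorem t2Drift_three_of_F2asym_Z0sym (hLc : 2 ≤ Lc) (cE cVH cΛ cE₂ cB : ℝ) (Tc : Fin 4 → Fin 4 → Fin 4 → Fin 4 → ℝ)
    {mixFF : BiTab 3} {CM₂ δ₄ : ℝ} (hmix : LocStencilFM Lc mixFF CM₂ δ₄) (hδ₄ : 0 < δ₄)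
    (hfm : ∀ κ u ρ w x z (α μ' : Fin (3 + 1)), mixFF κ u ρ w x z (Sum.inl α) (Sum.inr μ') = 0)
    (hm : ∀ κ u ρ w x z (μ' : Fin (3 + 1)) (b : Fib 3), mixFF κ u ρ w x z (Sum.inr μ') b = 0)
    (hmixt : ∀ (κ : Fin (3 + 1)) (u : Fin (3 + 1) → ℤ) (ρ : Fin (3 + 1)) (w t : Fin (3 + 1) → ℤ),
      mixFF κ (u + (Lc : ℤ) • t) ρ (w + t) = shiftK (-((Lc : ℤ) • t)) (mixFF κ u ρ w))
    (hpin : |cE₂| ≤ (Lc : ℝ) ^ (2 * (3 + 1)))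
    (hZ : ∀ m : ℕ, (∀ κ κ' κ₁ κ₂, zmode Lc (fun κ u κ' u' =>
        (cE₂ * (Lc : ℝ) ^ (2 * (3 + 1))) •
            mmRead Lc (K3OfK (unitK (sfStep Lc m) (smStep 3 Lc m) (KInvStep (d := 3) Lc m)) Lc
              (unitS (sfStep Lc m) (smStep 3 Lc m) (Spure 3 Lc cE cVH cΛ m)) (unitM (sfStep Lc m) (smStep 3 Lc m) (M1 3 Lc cΛ m))
              (W2SymOfK (unitK (sfStep Lc m) (smStep 3 Lc m) (KInvStep (d := 3) Lc m)) Lc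
                (unitS (sfStep Lc m) (smStep 3 Lc m) (Spure 3 Lc cE cVH cΛ m)) (unitM (sfStep Lc m) (smStep 3 Lc m) (M1 3 Lc cΛ m)) 0
                (unitM₂ (sfStep Lc m) (smStep 3 Lc m) (M2Of 3 Lc mixFF m))) κ u κ' u')
          + cB • mfNeg ((vh₂S 3 Lc) κ u κ' u')) κ κ' (Sum.inl κ₁) (Sum.inl κ₂) + zmode Lc (fun κ u κ' u' =>
        (cE₂ * (Lc : ℝ) ^ (2 * (3 + 1))) •
            mmRead Lc (K3OfK (unitK (sfStep Lc m) (smStep 3 Lc m) (KInvStep (d := 3) Lc m)) Lc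
              (unitS (sfStep Lc m) (smStep 3 Lc m) (Spure 3 Lc cE cVH cΛ m)) (unitM (sfStep Lc m) (smStep 3 Lc m) (M1 3 Lc cΛ m))
              (W2SymOfK (unitK (sfStep Lc m) (smStep 3 Lc m) (KInvStep (d := 3) Lc m)) Lc
                (unitS (sfStep Lc m) (smStep 3 Lc m) (Spure 3 Lc cE cVH cΛ m)) (unitM (sfStep Lc m) (smStep 3 Lc m) (M1 3 Lc cΛ m)) 0
                (unitM₂ (sfStep Lc m) (smStep 3 Lc m) (M2Of 3 Lc mixFF m))) κ u κ' u')
          + cB • mfNeg ((vh₂S 3 Lc) κ u κ' u')) κ' κ (Sum.inl κ₁) (Sum.inl κ₂) = 0))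
    (hZ0 : (∀ κ κ' κ₁ κ₂, zmode Lc (fun κ u κ' u' => unitS₂ (sfStep Lc 1) (smStep 3 Lc 1) (T2Of 3 Lc cE cVH cΛ cE₂ cB Tc (vh₂S 3 Lc) mixFF 1) κ u κ' u' - unitS₂ (sfStep Lc 0) (smStep 3 Lc 0) (T2Of 3 Lc cE cVH cΛ cE₂ cB Tc (vh₂S 3 Lc) mixFF 0) κ u κ' u') κ κ' (Sum.inl κ₁) (Sum.inl κ₂) + zmode Lc (fun κ u κ' u' => unitS₂ (sfStep Lc 1) (smStep 3 Lc 1) (T2Of 3 Lc cE cVH cΛ cE₂ cB Tc (vh₂S 3 Lc) mixFF 1) κ u κ' u' - unitS₂ (sfStep Lc 0) (smStep 3 Lc 0) (T2Of 3 Lc cE cVH cΛ cE₂ cB Tc (vh₂S 3 Lc) mixFF 0) κ u κ' u') κ' κ (Sum.inl κ₁) (Sum.inl κ₂) = 0)) :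
    ∃ c ϑ δT : ℝ, 0 ≤ c ∧ 0 < ϑ ∧ ϑ < 1 ∧ 0 < δT ∧
      (∀ n, LocStencil₂ (fun κ u κ' u' => unitS₂ (sfStep Lc (n + 1)) (smStep 3 Lc (n + 1)) (T2Of 3 Lc cE cVH cΛ cE₂ cB Tc (vh₂S 3 Lc) mixFF (n + 1)) κ u κ' u' - unitS₂ (sfStep Lc n) (smStep 3 Lc n) (T2Of 3 Lc cE cVH cΛ cE₂ cB Tc (vh₂S 3 Lc) mixFF n) κ u κ' u') (c * ϑ ^ n) δT) ∧
      (∀ k j, LocStencil₂ (fun κ u κ' u' => unitS₂ (sfStep Lc (k + j)) (smStep 3 Lc (k + j)) (T2Of 3 Lc cE cVH cΛ cE₂ cB Tc (vh₂S 3 Lc) mixFF (k + j)) κ u κ' u' - unitS₂ (sfStep Lc k) (smStep 3 Lc k) (T2Of 3 Lc cE cVH cΛ cE₂ cB Tc (vh₂S 3 Lc) mixFF k) κ u κ' u') (c * (1 - ϑ)⁻¹ * ϑ ^ k) δT) ∧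
      (∀ n κ u κ' u' x z a b, |unitS₂ (sfStep Lc (n + 1)) (smStep 3 Lc (n + 1)) (T2Of 3 Lc cE cVH cΛ cE₂ cB Tc (vh₂S 3 Lc) mixFF (n + 1)) κ u κ' u' x z a b - unitS₂ (sfStep Lc n) (smStep 3 Lc n) (T2Of 3 Lc cE cVH cΛ cE₂ cB Tc (vh₂S 3 Lc) mixFF n) κ u κ' u' x z a b| ≤ c * ϑ ^ n) := by
  have hLc1 : 1 ≤ Lc := one_le_of_two_le hLc
  obtain ⟨C, δ, cK, θK, hδ, -, -, hK, -⟩ := convCKWall_holds (Lc := Lc) hLc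
  obtain ⟨Cf, θ, δf, hCf, hθ0, hθ1, hδf, hf⟩ := hf_three_of_F2asym hLc cE cVH cΛ cE₂ cB Tc hmix hδ₄ hfm hm hmixt hpin hZ
  obtain ⟨C₀, δ₀, hδ₀, h0⟩ := hD0_pair (d := 3) hLc1 cE cVH cΛ cE₂ cB Tc ⟨CM₂, δ₄, hδ₄, hmix⟩
  obtain ⟨Cb, δb, hCb, hδb, hb⟩ := hb_three hLc cE cVH cΛ cE₂ cB hmix hδ₄ hfm hm
  obtain ⟨CT', δT, hCT', hδT, -, hTi⟩ := hTirr_three_symZ_slot hLc1 hK hδ cE₂ (lt_min hδf hδ₀) (fun _ => (0 : ℝ))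
  obtain ⟨c, ϑ, hc, hϑ0, hϑ1, h1, h2, h3⟩ := t2Drift_of_rows (d := 3) cE cVH cΛ cE₂ cB Tc mixFF
    (fun m => ((lin4 (cE₂ * (Lc : ℝ) ^ (2 * (3 + 1))) (unitK (sfStep Lc (m + 1)) (smStep 3 Lc (m + 1)) (KInvStep (d := 3) Lc (m + 1))) Lc
              (unitS₂ (sfStep Lc m) (smStep 3 Lc m) (T2Of 3 Lc cE cVH cΛ cE₂ cB Tc (vh₂S 3 Lc) mixFF m))
          - lin4 (cE₂ * (Lc : ℝ) ^ (2 * (3 + 1))) (unitK (sfStep Lc m) (smStep 3 Lc m) (KInvStep (d := 3) Lc m)) Lc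
              (unitS₂ (sfStep Lc m) (smStep 3 Lc m) (T2Of 3 Lc cE cVH cΛ cE₂ cB Tc (vh₂S 3 Lc) mixFF m)))
        + ((fun κ u κ' u' =>
        (cE₂ * (Lc : ℝ) ^ (2 * (3 + 1))) •
            mmRead Lc (K3OfK (unitK (sfStep Lc (m + 1)) (smStep 3 Lc (m + 1)) (KInvStep (d := 3) Lc (m + 1))) Lc
              (unitS (sfStep Lc (m + 1)) (smStep 3 Lc (m + 1)) (Spure 3 Lc cE cVH cΛ (m + 1))) (unitM (sfStep Lc (m + 1)) (smStep 3 Lc (m + 1)) (M1 3 Lc cΛ (m + 1)))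
              (W2SymOfK (unitK (sfStep Lc (m + 1)) (smStep 3 Lc (m + 1)) (KInvStep (d := 3) Lc (m + 1))) Lc
                (unitS (sfStep Lc (m + 1)) (smStep 3 Lc (m + 1)) (Spure 3 Lc cE cVH cΛ (m + 1))) (unitM (sfStep Lc (m + 1)) (smStep 3 Lc (m + 1)) (M1 3 Lc cΛ (m + 1))) 0
                (unitM₂ (sfStep Lc (m + 1)) (smStep 3 Lc (m + 1)) (M2Of 3 Lc mixFF (m + 1)))) κ u κ' u')
          + cB • mfNeg ((vh₂S 3 Lc) κ u κ' u'))
          - (fun κ u κ' u' =>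
        (cE₂ * (Lc : ℝ) ^ (2 * (3 + 1))) •
            mmRead Lc (K3OfK (unitK (sfStep Lc m) (smStep 3 Lc m) (KInvStep (d := 3) Lc m)) Lc
              (unitS (sfStep Lc m) (smStep 3 Lc m) (Spure 3 Lc cE cVH cΛ m)) (unitM (sfStep Lc m) (smStep 3 Lc m) (M1 3 Lc cΛ m))
              (W2SymOfK (unitK (sfStep Lc m) (smStep 3 Lc m) (KInvStep (d := 3) Lc m)) Lc
                (unitS (sfStep Lc m) (smStep 3 Lc m) (Spure 3 Lc cE cVH cΛ m)) (unitM (sfStep Lc m) (smStep 3 Lc m) (M1 3 Lc cΛ m)) 0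
                (unitM₂ (sfStep Lc m) (smStep 3 Lc m) (M2Of 3 Lc mixFF m))) κ u κ' u')
          + cB • mfNeg ((vh₂S 3 Lc) κ u κ' u')))))
    (fun m k => transport (fun j => lin4 (cE₂ * (Lc : ℝ) ^ (2 * (3 + 1))) (unitK (sfStep Lc j) (smStep 3 Lc j) (KInvStep (d := 3) Lc j)) Lc) (m + 1) k)
    (fun X => (∀ κ u κ' u' t, X κ (u + (Lc : ℤ) • t) κ' (u' + (Lc : ℤ) • t) = shiftK (-((Lc : ℤ) • t)) (X κ u κ' u')) ∧
      (∀ κ κ' κ₁ κ₂, zmode Lc X κ κ' (Sum.inl κ₁) (Sum.inl κ₂) + zmode Lc X κ' κ (Sum.inl κ₁) (Sum.inl κ₂) = 0))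
    (fun _ => (0 : ℝ)) hδT hCT' inv_natCast_nonneg (inv_natCast_lt_one hLc) hθ0 hθ1
    (fun n => unitS₂_T2Of_sub_eq_transport_add_sum_vh₂S_of_mix cE cVH cΛ cE₂ cB Tc mixFF hLc1 ⟨CM₂, δ₄, hδ₄, hmix⟩ n)
    (fun m k X C' hC hX hZX hmX => hTi hpin (m + 1) k X C' hC hX hZX hmX)
    (hf (min_le_left _ _))
    (fun m => forcing_zfreeSym_of_source (d := 3) hLc1 cE cVH cΛ cE₂ cB Tc ⟨CM₂, δ₄, hδ₄, hmix⟩ hmixt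
      (fun j => (fun κ u κ' u' =>
        (cE₂ * (Lc : ℝ) ^ (2 * (3 + 1))) •
            mmRead Lc (K3OfK (unitK (sfStep Lc j) (smStep 3 Lc j) (KInvStep (d := 3) Lc j)) Lc
              (unitS (sfStep Lc j) (smStep 3 Lc j) (Spure 3 Lc cE cVH cΛ j)) (unitM (sfStep Lc j) (smStep 3 Lc j) (M1 3 Lc cΛ j))
              (W2SymOfK (unitK (sfStep Lc j) (smStep 3 Lc j) (KInvStep (d := 3) Lc j)) Lc
                (unitS (sfStep Lc j) (smStep 3 Lc j) (Spure 3 Lc cE cVH cΛ j)) (unitM (sfStep Lc j) (smStep 3 Lc j) (M1 3 Lc cΛ j)) 0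
                (unitM₂ (sfStep Lc j) (smStep 3 Lc j) (M2Of 3 Lc mixFF j))) κ u κ' u')
          + cB • mfNeg ((vh₂S 3 Lc) κ u κ' u')))
      (fun j κ u κ' u' t => bracket_translate_block_base (d := 3) hLc1 cE cVH cΛ cE₂ cB hmixt j κ u κ' u' t)
      hδb (fun j => (hb le_rfl j).1) hZ m)
    (h0 _ (min_le_right _ _))
    ⟨fun κ u κ' u' t => T2diff_translate (d := 3) hLc1 cE cVH cΛ cE₂ cB Tc hmixt 0 κ u κ' u' t, hZ0⟩
  exact ⟨c, ϑ, δT, hc, hϑ0, hϑ1, hδT, h1, h2, h3⟩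

end Three

/-! ## §2 an1's mixed table at a box root (the `ZfreeSym` currency; covariance and ROWS-MIX are free) -/

section An1

variable {Lc : ℕ} [NeZero Lc] {r : Fin (3 + 1) → ℕ}

/-- **END #2 COMPOSED BY NAME FOR an1's MIXED TABLE `mixFFAt (toSite r) Lc` (`r ∈ box (3+1) Lc`), `ZfreeSym` currency**: «T2Drift» ⇐ pin ∧ ROW
W3-F2a's bond-symmetrised cell charges ∧ the bond-symmetrised cell charge of the first difference (ROWS-MIX and `hmixt` by
`MixedJetTablesPlug.hmix_an1` ∕ `hmixt_an1`, `WSlotMixedShape.mixFFAt_hfm` ∕ `mixFFAt_hm`). -/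
theorem t2Drift_three_an1_of_F2asym_Z0sym (hLc : 2 ≤ Lc) (hr : r ∈ box (3 + 1) Lc) (cE cVH cΛ cE₂ cB : ℝ)
    (Tc : Fin 4 → Fin 4 → Fin 4 → Fin 4 → ℝ)
    (hpin : |cE₂| ≤ (Lc : ℝ) ^ (2 * (3 + 1)))
    (hZ : ∀ m : ℕ, (∀ κ κ' κ₁ κ₂, zmode Lc (fun κ u κ' u' =>
        (cE₂ * (Lc : ℝ) ^ (2 * (3 + 1))) •
            mmRead Lc (K3OfK (unitK (sfStep Lc m) (smStep 3 Lc m) (KInvStep (d := 3) Lc m)) Lc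
              (unitS (sfStep Lc m) (smStep 3 Lc m) (Spure 3 Lc cE cVH cΛ m)) (unitM (sfStep Lc m) (smStep 3 Lc m) (M1 3 Lc cΛ m))
              (W2SymOfK (unitK (sfStep Lc m) (smStep 3 Lc m) (KInvStep (d := 3) Lc m)) Lc
                (unitS (sfStep Lc m) (smStep 3 Lc m) (Spure 3 Lc cE cVH cΛ m)) (unitM (sfStep Lc m) (smStep 3 Lc m) (M1 3 Lc cΛ m)) 0
                (unitM₂ (sfStep Lc m) (smStep 3 Lc m) (M2Of 3 Lc (mixFFAt (toSite r) Lc) m))) κ u κ' u')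
          + cB • mfNeg ((vh₂S 3 Lc) κ u κ' u')) κ κ' (Sum.inl κ₁) (Sum.inl κ₂) + zmode Lc (fun κ u κ' u' =>
        (cE₂ * (Lc : ℝ) ^ (2 * (3 + 1))) •
            mmRead Lc (K3OfK (unitK (sfStep Lc m) (smStep 3 Lc m) (KInvStep (d := 3) Lc m)) Lc
              (unitS (sfStep Lc m) (smStep 3 Lc m) (Spure 3 Lc cE cVH cΛ m)) (unitM (sfStep Lc m) (smStep 3 Lc m) (M1 3 Lc cΛ m))
              (W2SymOfK (unitK (sfStep Lc m) (smStep 3 Lc m) (KInvStep (d := 3) Lc m)) Lc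
                (unitS (sfStep Lc m) (smStep 3 Lc m) (Spure 3 Lc cE cVH cΛ m)) (unitM (sfStep Lc m) (smStep 3 Lc m) (M1 3 Lc cΛ m)) 0
                (unitM₂ (sfStep Lc m) (smStep 3 Lc m) (M2Of 3 Lc (mixFFAt (toSite r) Lc) m))) κ u κ' u')
          + cB • mfNeg ((vh₂S 3 Lc) κ u κ' u')) κ' κ (Sum.inl κ₁) (Sum.inl κ₂) = 0))
    (hZ0 : (∀ κ κ' κ₁ κ₂, zmode Lc (fun κ u κ' u' => unitS₂ (sfStep Lc 1) (smStep 3 Lc 1) (T2Of 3 Lc cE cVH cΛ cE₂ cB Tc (vh₂S 3 Lc) (mixFFAt (toSite r) Lc) 1) κ u κ' u' - unitS₂ (sfStep Lc 0) (smStep 3 Lc 0) (T2Of 3 Lc cE cVH cΛ cE₂ cB Tc (vh₂S 3 Lc) (mixFFAt (toSite r) Lc) 0) κ u κ' u') κ κ' (Sum.inl κ₁) (Sum.inl κ₂) + zmode Lc (fun κ u κ' u' => unitS₂ (sfStep Lc 1) (smStep 3 Lc 1) (T2Of 3 Lc cE cVH cΛ cE₂ cB Tc (vh₂S 3 Lc)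 (mixFFAt (toSite r) Lc) 1) κ u κ' u' - unitS₂ (sfStep Lc 0) (smStep 3 Lc 0) (T2Of 3 Lc cE cVH cΛ cE₂ cB Tc (vh₂S 3 Lc) (mixFFAt (toSite r) Lc) 0) κ u κ' u') κ' κ (Sum.inl κ₁) (Sum.inl κ₂) = 0)) :
    ∃ c ϑ δT : ℝ, 0 ≤ c ∧ 0 < ϑ ∧ ϑ < 1 ∧ 0 < δT ∧
      (∀ n, LocStencil₂ (fun κ u κ' u' => unitS₂ (sfStep Lc (n + 1)) (smStep 3 Lc (n + 1)) (T2Of 3 Lc cE cVH cΛ cE₂ cB Tc (vh₂S 3 Lc) (mixFFAt (toSite r) Lc) (n + 1)) κ u κ' u' - unitS₂ (sfStep Lc n) (smStep 3 Lc n) (T2Of 3 Lc cE cVH cΛ cE₂ cB Tc (vh₂S 3 Lc) (mixFFAt (toSite r) Lc) n) κ u κ' u') (c * ϑ ^ n) δT) ∧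
      (∀ k j, LocStencil₂ (fun κ u κ' u' => unitS₂ (sfStep Lc (k + j)) (smStep 3 Lc (k + j)) (T2Of 3 Lc cE cVH cΛ cE₂ cB Tc (vh₂S 3 Lc) (mixFFAt (toSite r) Lc) (k + j)) κ u κ' u' - unitS₂ (sfStep Lc k) (smStep 3 Lc k) (T2Of 3 Lc cE cVH cΛ cE₂ cB Tc (vh₂S 3 Lc) (mixFFAt (toSite r) Lc) k) κ u κ' u') (c * (1 - ϑ)⁻¹ * ϑ ^ k) δT) ∧
      (∀ n κ u κ' u' x z a b, |unitS₂ (sfStep Lc (n + 1)) (smStep 3 Lc (n + 1)) (T2Of 3 Lc cE cVH cΛ cE₂ cB Tc (vh₂S 3 Lc) (mixFFAt (toSite r) Lc) (n + 1)) κ u κ' u' x z a b - unitS₂ (sfStep Lc n) (smStep 3 Lc n) (T2Of 3 Lc cE cVH cΛ cE₂ cB Tc (vh₂S 3 Lc) (mixFFAt (toSite r) Lc) n) κ u κ' u' x z a b| ≤ c * ϑ ^ n) := by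
  obtain ⟨CM₂, δ₄, hδ₄, hmix⟩ := hmix_an1 (d := 3) (Lc := Lc) (one_le_of_two_le hLc) hr
  exact t2Drift_three_of_F2asym_Z0sym hLc cE cVH cΛ cE₂ cB Tc hmix hδ₄ (mixFFAt_hfm _) (mixFFAt_hm _) (hmixt_an1 (toSite r)) hpin hZ hZ0

end An1

/-! ## §3 Both ENDs at once in the `ZfreeSym` currency (one `obtain` for an assembler) -/

section Both

variable {Lc : ℕ} [NeZero Lc] {r : Fin (3 + 1) → ℕ}

/-- **«T2Shape» ∧ «T2Drift» AT `d = 3`, generic block-covariant mixed table, MODULO ROW W3-F2a (bond-symmetrised cell charges), ROW W3-F4d's pin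
half (same currency) AND THE PIN** [folklore conjunction: leaf-12's `T2ShapeThreeOfF2a.t2Shape_three_of_F2a_symZ` (covariance by
`bracket_translate_block_base`) ∧ `t2Drift_three_of_F2asym_Z0sym`]. -/
theorem t2ShapeDrift_three_of_F2asym_Z0sym (hLc : 2 ≤ Lc) (cE cVH cΛ cE₂ cB : ℝ) (Tc : Fin 4 → Fin 4 → Fin 4 → Fin 4 → ℝ)
    {mixFF : BiTab 3} {CM₂ δ₄ : ℝ} (hmix : LocStencilFM Lc mixFF CM₂ δ₄) (hδ₄ : 0 < δ₄)
    (hfm : ∀ κ u ρ w x z (α μ' : Fin (3 + 1)), mixFF κ u ρ w x z (Sum.inl α) (Sum.inr μ') = 0)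
    (hm : ∀ κ u ρ w x z (μ' : Fin (3 + 1)) (b : Fib 3), mixFF κ u ρ w x z (Sum.inr μ') b = 0)
    (hmixt : ∀ (κ : Fin (3 + 1)) (u : Fin (3 + 1) → ℤ) (ρ : Fin (3 + 1)) (w t : Fin (3 + 1) → ℤ),
      mixFF κ (u + (Lc : ℤ) • t) ρ (w + t) = shiftK (-((Lc : ℤ) • t)) (mixFF κ u ρ w))
    (hpin : |cE₂| ≤ (Lc : ℝ) ^ (2 * (3 + 1)))
    (hZ : ∀ m : ℕ, (∀ κ κ' κ₁ κ₂, zmode Lc (fun κ u κ' u' =>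
        (cE₂ * (Lc : ℝ) ^ (2 * (3 + 1))) •
            mmRead Lc (K3OfK (unitK (sfStep Lc m) (smStep 3 Lc m) (KInvStep (d := 3) Lc m)) Lc
              (unitS (sfStep Lc m) (smStep 3 Lc m) (Spure 3 Lc cE cVH cΛ m)) (unitM (sfStep Lc m) (smStep 3 Lc m) (M1 3 Lc cΛ m))
              (W2SymOfK (unitK (sfStep Lc m) (smStep 3 Lc m) (KInvStep (d := 3) Lc m)) Lc
                (unitS (sfStep Lc m) (smStep 3 Lc m) (Spure 3 Lc cE cVH cΛ m)) (unitM (sfStep Lc m) (smStep 3 Lc m) (M1 3 Lc cΛ m)) 0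
                (unitM₂ (sfStep Lc m) (smStep 3 Lc m) (M2Of 3 Lc mixFF m))) κ u κ' u')
          + cB • mfNeg ((vh₂S 3 Lc) κ u κ' u')) κ κ' (Sum.inl κ₁) (Sum.inl κ₂) + zmode Lc (fun κ u κ' u' =>
        (cE₂ * (Lc : ℝ) ^ (2 * (3 + 1))) •
            mmRead Lc (K3OfK (unitK (sfStep Lc m) (smStep 3 Lc m) (KInvStep (d := 3) Lc m)) Lc
              (unitS (sfStep Lc m) (smStep 3 Lc m) (Spure 3 Lc cE cVH cΛ m)) (unitM (sfStep Lc m) (smStep 3 Lc m) (M1 3 Lc cΛ m))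
              (W2SymOfK (unitK (sfStep Lc m) (smStep 3 Lc m) (KInvStep (d := 3) Lc m)) Lc
                (unitS (sfStep Lc m) (smStep 3 Lc m) (Spure 3 Lc cE cVH cΛ m)) (unitM (sfStep Lc m) (smStep 3 Lc m) (M1 3 Lc cΛ m)) 0
                (unitM₂ (sfStep Lc m) (smStep 3 Lc m) (M2Of 3 Lc mixFF m))) κ u κ' u')
          + cB • mfNeg ((vh₂S 3 Lc) κ u κ' u')) κ' κ (Sum.inl κ₁) (Sum.inl κ₂) = 0))
    (hZ0 : (∀ κ κ' κ₁ κ₂, zmode Lc (fun κ u κ' u' => unitS₂ (sfStep Lc 1) (smStep 3 Lc 1) (T2Of 3 Lc cE cVH cΛ cE₂ cB Tc (vh₂S 3 Lc) mixFF 1) κ u κ' u' - unitS₂ (sfStep Lc 0) (smStep 3 Lc 0) (T2Of 3 Lc cE cVH cΛ cE₂ cB Tc (vh₂S 3 Lc) mixFF 0) κ u κ' u') κ κ' (Sum.inl κ₁) (Sum.inl κ₂) + zmode Lc (fun κ u κ' u' => unitS₂ (sfStep Lc 1) (smStep 3 Lc 1) (T2Of 3 Lc cE cVH cΛ cE₂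 cB Tc (vh₂S 3 Lc) mixFF 1) κ u κ' u' - unitS₂ (sfStep Lc 0) (smStep 3 Lc 0) (T2Of 3 Lc cE cVH cΛ cE₂ cB Tc (vh₂S 3 Lc) mixFF 0) κ u κ' u') κ' κ (Sum.inl κ₁) (Sum.inl κ₂) = 0)) :
    (∃ C₂ δ₂ : ℝ, 0 < δ₂ ∧ ∀ j, LocStencil₂ (unitS₂ (sfStep Lc j) (smStep 3 Lc j) (T2Of 3 Lc cE cVH cΛ cE₂ cB Tc (vh₂S 3 Lc) mixFF j)) C₂ δ₂) ∧
    (∃ c ϑ δT : ℝ, 0 ≤ c ∧ 0 < ϑ ∧ ϑ < 1 ∧ 0 < δT ∧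
      (∀ n, LocStencil₂ (fun κ u κ' u' => unitS₂ (sfStep Lc (n + 1)) (smStep 3 Lc (n + 1)) (T2Of 3 Lc cE cVH cΛ cE₂ cB Tc (vh₂S 3 Lc) mixFF (n + 1)) κ u κ' u' - unitS₂ (sfStep Lc n) (smStep 3 Lc n) (T2Of 3 Lc cE cVH cΛ cE₂ cB Tc (vh₂S 3 Lc) mixFF n) κ u κ' u') (c * ϑ ^ n) δT) ∧
      (∀ k j, LocStencil₂ (fun κ u κ' u' => unitS₂ (sfStep Lc (k + j)) (smStep 3 Lc (k + j)) (T2Of 3 Lc cE cVH cΛ cE₂ cB Tc (vh₂S 3 Lc) mixFF (k + j)) κ u κ' u' - unitS₂ (sfStep Lc k) (smStep 3 Lc k) (T2Of 3 Lc cE cVH cΛ cE₂ cB Tc (vh₂S 3 Lc) mixFF k) κ u κ' u') (c * (1 - ϑ)⁻¹ * ϑ ^ k) δT) ∧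
      (∀ n κ u κ' u' x z a b, |unitS₂ (sfStep Lc (n + 1)) (smStep 3 Lc (n + 1)) (T2Of 3 Lc cE cVH cΛ cE₂ cB Tc (vh₂S 3 Lc) mixFF (n + 1)) κ u κ' u' x z a b - unitS₂ (sfStep Lc n) (smStep 3 Lc n) (T2Of 3 Lc cE cVH cΛ cE₂ cB Tc (vh₂S 3 Lc) mixFF n) κ u κ' u' x z a b| ≤ c * ϑ ^ n)) :=
  ⟨t2Shape_three_of_F2a_symZ hLc cE cVH cΛ cE₂ cB Tc hmix hδ₄ hfm hm hpin
      (fun m => ⟨fun κ u κ' u' t => bracket_translate_block_base (d := 3) (one_le_of_two_le hLc) cE cVH cΛ cE₂ cB hmixt m κ u κ' u' t, hZ m⟩),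
    t2Drift_three_of_F2asym_Z0sym hLc cE cVH cΛ cE₂ cB Tc hmix hδ₄ hfm hm hmixt hpin hZ hZ0⟩

/-- **«T2Shape» ∧ «T2Drift» AT `d = 3` FOR an1's MIXED TABLE `mixFFAt (toSite r) Lc` (`r ∈ box (3+1) Lc`), `ZfreeSym` currency, MODULO ROW W3-F2a,
ROW W3-F4d's pin half AND THE PIN** [folklore conjunction: leaf-12's `t2Shape_three_an1_of_F2a_symZ` ∧ §2]. -/
theorem t2ShapeDrift_three_an1_of_F2asym_Z0sym (hLc : 2 ≤ Lc) (hr : r ∈ box (3 + 1) Lc) (cE cVH cΛ cE₂ cB : ℝ)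
    (Tc : Fin 4 → Fin 4 → Fin 4 → Fin 4 → ℝ)
    (hpin : |cE₂| ≤ (Lc : ℝ) ^ (2 * (3 + 1)))
    (hZ : ∀ m : ℕ, (∀ κ κ' κ₁ κ₂, zmode Lc (fun κ u κ' u' =>
        (cE₂ * (Lc : ℝ) ^ (2 * (3 + 1))) •
            mmRead Lc (K3OfK (unitK (sfStep Lc m) (smStep 3 Lc m) (KInvStep (d := 3) Lc m)) Lc
              (unitS (sfStep Lc m) (smStep 3 Lc m) (Spure 3 Lc cE cVH cΛ m)) (unitM (sfStep Lc m) (smStep 3 Lc m) (M1 3 Lc cΛ m))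
              (W2SymOfK (unitK (sfStep Lc m) (smStep 3 Lc m) (KInvStep (d := 3) Lc m)) Lc
                (unitS (sfStep Lc m) (smStep 3 Lc m) (Spure 3 Lc cE cVH cΛ m)) (unitM (sfStep Lc m) (smStep 3 Lc m) (M1 3 Lc cΛ m)) 0
                (unitM₂ (sfStep Lc m) (smStep 3 Lc m) (M2Of 3 Lc (mixFFAt (toSite r) Lc) m))) κ u κ' u')
          + cB • mfNeg ((vh₂S 3 Lc) κ u κ' u')) κ κ' (Sum.inl κ₁) (Sum.inl κ₂) + zmode Lc (fun κ u κ' u' =>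
        (cE₂ * (Lc : ℝ) ^ (2 * (3 + 1))) •
            mmRead Lc (K3OfK (unitK (sfStep Lc m) (smStep 3 Lc m) (KInvStep (d := 3) Lc m)) Lc
              (unitS (sfStep Lc m) (smStep 3 Lc m) (Spure 3 Lc cE cVH cΛ m)) (unitM (sfStep Lc m) (smStep 3 Lc m) (M1 3 Lc cΛ m))
              (W2SymOfK (unitK (sfStep Lc m) (smStep 3 Lc m) (KInvStep (d := 3) Lc m)) Lc
                (unitS (sfStep Lc m) (smStep 3 Lc m) (Spure 3 Lc cE cVH cΛ m)) (unitM (sfStep Lc m) (smStep 3 Lc m) (M1 3 Lc cΛ m)) 0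
                (unitM₂ (sfStep Lc m) (smStep 3 Lc m) (M2Of 3 Lc (mixFFAt (toSite r) Lc) m))) κ u κ' u')
          + cB • mfNeg ((vh₂S 3 Lc) κ u κ' u')) κ' κ (Sum.inl κ₁) (Sum.inl κ₂) = 0))
    (hZ0 : (∀ κ κ' κ₁ κ₂, zmode Lc (fun κ u κ' u' => unitS₂ (sfStep Lc 1) (smStep 3 Lc 1) (T2Of 3 Lc cE cVH cΛ cE₂ cB Tc (vh₂S 3 Lc) (mixFFAt (toSite r) Lc) 1) κ u κ' u' - unitS₂ (sfStep Lc 0) (smStep 3 Lc 0) (T2Of 3 Lc cE cVH cΛ cE₂ cB Tc (vh₂S 3 Lc) (mixFFAt (toSite r) Lc) 0) κ u κ' u') κ κ' (Sum.inl κ₁) (Sum.inl κ₂) + zmode Lc (fun κ u κ' u' => unitS₂ (sfStep Lc 1) (smStep 3 Lc 1) (T2Of 3 Lc cE cVH cΛ cE₂ cB Tc (vh₂S 3 Lc) (mixFFAt (toSite r) Lc) 1) κ u κ' u' - unitS₂ (sfStep Lc 0) (smStep 3 Lc 0) (T2Of 3 Lc cE cVH cΛ cE₂ cB Tc (vh₂S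 3 Lc) (mixFFAt (toSite r) Lc) 0) κ u κ' u') κ' κ (Sum.inl κ₁) (Sum.inl κ₂) = 0)) :
    (∃ C₂ δ₂ : ℝ, 0 < δ₂ ∧ ∀ j, LocStencil₂ (unitS₂ (sfStep Lc j) (smStep 3 Lc j) (T2Of 3 Lc cE cVH cΛ cE₂ cB Tc (vh₂S 3 Lc) (mixFFAt (toSite r) Lc) j)) C₂ δ₂) ∧
    (∃ c ϑ δT : ℝ, 0 ≤ c ∧ 0 < ϑ ∧ ϑ < 1 ∧ 0 < δT ∧
      (∀ n, LocStencil₂ (fun κ u κ' u' => unitS₂ (sfStep Lc (n + 1)) (smStep 3 Lc (n + 1)) (T2Of 3 Lc cE cVH cΛ cE₂ cB Tc (vh₂S 3 Lc) (mixFFAt (toSite r) Lc) (n + 1)) κ u κ' u' - unitS₂ (sfStep Lc n) (smStep 3 Lc n) (T2Of 3 Lc cE cVH cΛ cE₂ cB Tc (vh₂S 3 Lc) (mixFFAt (toSite r) Lc) n) κ u κ' u') (c * ϑ ^ n) δT) ∧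
      (∀ k j, LocStencil₂ (fun κ u κ' u' => unitS₂ (sfStep Lc (k + j)) (smStep 3 Lc (k + j)) (T2Of 3 Lc cE cVH cΛ cE₂ cB Tc (vh₂S 3 Lc) (mixFFAt (toSite r) Lc) (k + j)) κ u κ' u' - unitS₂ (sfStep Lc k) (smStep 3 Lc k) (T2Of 3 Lc cE cVH cΛ cE₂ cB Tc (vh₂S 3 Lc) (mixFFAt (toSite r) Lc) k) κ u κ' u') (c * (1 - ϑ)⁻¹ * ϑ ^ k) δT) ∧
      (∀ n κ u κ' u' x z a b, |unitS₂ (sfStep Lc (n + 1)) (smStep 3 Lc (n + 1)) (T2Of 3 Lc cE cVH cΛ cE₂ cB Tc (vh₂S 3 Lc) (mixFFAt (toSite r) Lc) (n + 1)) κ u κ' u' x z a b - unitS₂ (sfStep Lc n) (smStep 3 Lc n) (T2Of 3 Lc cE cVH cΛ cE₂ cB Tc (vh₂S 3 Lc) (mixFFAt (toSite r) Lc) n) κ u κ' u' x z a b| ≤ c * ϑ ^ n)) :=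
  ⟨t2Shape_three_an1_of_F2a_symZ hLc hr cE cVH cΛ cE₂ cB Tc hpin hZ,
    t2Drift_three_an1_of_F2asym_Z0sym hLc hr cE cVH cΛ cE₂ cB Tc hpin hZ hZ0⟩

end Both

end Summit.QuantumFields.BalabanUV.Beta.GAN24.W3DriftOfZS

end
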